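import Literature.Probability.LatticeModels.MedialInterfaceProofs
import HarnessLib

/-!
# The winding of the medial exploration path: every step turns by `± π / 2`

Topic `Literature/Probability/LatticeModels`; companion of `MedialInterfaceProofs.lean` (the
exploration path as the cut orbit `explorationList β c₀ N` of the successor map `nextCorner β`
on coded corners) and of `FermionicObservable.lean` (`turning`, `winding`, `windingAt`: the
winding of the polyline through the medial points, which enters Smirnov's fermionic observable
`fkFermionicObservable` through `exp (-i σ · windingAt)`). Second instalment of the discharge
programme for crit-ising.S18 (node 1, s-holomorphicity, needs the winding of the interface in
closed form). Everything here is proved: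

* coordinates: `Site.toComplex (cornerUnit k) = I ^ k`, the medial points of the source and
  target edges of a coded corner (`medialPoint_cSrc`, `medialPoint_cTgt`);
* **each step of the exploration turns by `±π/2`** (`turning_nextCorner`): following an open
  edge is a right turn `-π/2` (clockwise inside the face, `turning_nextCorner_of_mem`), crossing
  a closed edge is a left turn `+π/2` (counter-clockwise around the vertex,
  `turning_nextCorner_of_not_mem`) — the increments of the polyline are `δ I^k (I - 1)/2` and
  their ratio is exactly `∓ I`;
* **the winding of the exploration polyline is the sum of its turns** (`winding_orbitPts`), and
  the closed form of `windingAt` along the exploration path (`windingAt_explorationList`: the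
  average of the arrival and departure windings, i.e. `(π/2)(#left - #right turns so far) ± π/4`;
  `windingAt_explorationList_last`), with the integer turn signs `turnSign` (`turnOf_eq`,
  `sum_turnOf_eq`).

Sources: Smirnov, C. R. Acad. Sci. Paris 333 (2001), §2 (the exploration process turns left or
right at every step); Smirnov, Ann. Math. 172 (2010), §2.2 and §4 (the winding `w(γ, z)` of the
interface "measured in radians", "the number of `±π/2` turns with sign", entering the complex
weight `exp(-i w/2)`). Mathlib: `Complex.arg_I`, `Complex.arg_neg_I`, `List.take_range`.
-/

noncomputable section

namespace Literature.Probability.LatticeModels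

open Complex

/-! ### Lattice sites as complex numbers -/

/-- `Site.toComplex` is additive (local copy of `Literature.Probability.Percolation.toComplex_add`
of `LatticeTraceGeometry.lean`, not imported to keep this file light). [folklore] -/
private theorem toComplex_add' (x y : Site 2) : Site.toComplex (x + y) = Site.toComplex x + Site.toComplex y := by
  apply Complex.ext <;> simp [Site.toComplex]

/-- The four unit vectors of `ℤ²` as complex numbers: `cornerUnit k ↦ I ^ k`. [folklore] -/
theorem toComplex_cornerUnit (k : Fin 4) : Site.toComplex (cornerUnit k) = I ^ (k : ℕ) := by
  fin_cases k <;> apply Complex.ext <;> simp [Site.toComplex, cornerUnit, pow_succ]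

/-- The next unit vector counter-clockwise is the previous one times `I`. [folklore] -/
theorem toComplex_cornerUnit_succ (k : Fin 4) : Site.toComplex (cornerUnit (k + 1)) = I ^ (k : ℕ) * I := by
  fin_cases k <;> apply Complex.ext <;> simp [Site.toComplex, cornerUnit, pow_succ]

/-- Mesh points are additive (local copy of `meshPoint_add` of `InterfaceSLETightness.lean`, not
imported to keep this file light). [folklore] -/
private theorem meshPoint_add' (δ : ℝ) (x y : Site 2) : meshPoint δ (x + y) = meshPoint δ x + meshPoint δ y := by
  rw [meshPoint, meshPoint, meshPoint, toComplex_add', mul_add]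

/-- The midpoint of the source edge of the coded corner `(v, k)` at mesh `δ`:
`δ v + δ I^k / 2`. [cite: Smirnov2001, §2] -/
theorem medialPoint_cSrc (δ : ℝ) (p : Site 2 × Fin 4) :
    medialPoint δ (cSrc p) = meshPoint δ p.1 + (δ : ℂ) * I ^ (p.2 : ℕ) / 2 := by
  rw [cSrc, medialPoint_mk, meshPoint_add', meshPoint, meshPoint, toComplex_cornerUnit]
  ring

/-- The midpoint of the target edge of `(v, k)`: `δ v + δ I^k I / 2`. [cite: Smirnov2001, §2] -/
theorem medialPoint_cTgt (δ : ℝ) (p : Site 2 × Fin 4) :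
    medialPoint δ (cTgt p) = meshPoint δ p.1 + (δ : ℂ) * (I ^ (p.2 : ℕ) * I) / 2 := by
  rw [cTgt, medialPoint_mk, meshPoint_add', meshPoint, meshPoint, toComplex_cornerUnit_succ]
  ring

/-- Index arithmetic: `I ^ (k + 1) = I ^ k * I` with the successor taken in `Fin 4` (`I ^ 4 = 1`).
[folklore] -/
theorem I_pow_fin_succ (k : Fin 4) : I ^ ((k + 1 : Fin 4) : ℕ) = I ^ (k : ℕ) * I := by
  fin_cases k <;> simp [pow_succ]

/-- Index arithmetic: `I ^ (k + 3) * I = I ^ k` with `k + 3` taken in `Fin 4`. [folklore] -/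
theorem I_pow_fin_add_three_mul_I (k : Fin 4) : I ^ ((k + 3 : Fin 4) : ℕ) * I = I ^ (k : ℕ) := by
  fin_cases k <;> simp [pow_succ]

/-- `I - 1 ≠ 0`. [folklore] -/
theorem I_sub_one_ne_zero : (I : ℂ) - 1 ≠ 0 := by
  intro h
  have := congrArg Complex.re h
  simp at this

/-- `I + 1 ≠ 0`. [folklore] -/
theorem I_add_one_ne_zero : (I : ℂ) + 1 ≠ 0 := by
  intro h
  have := congrArg Complex.re h
  simp at this

variable {β : Percolation.BondConfig (Site 2)}

/-- **Crossing a closed edge is a left turn.** If the target edge of the corner `p` is closed,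
the polyline through the midpoints of `cSrc p`, `cTgt p`, `cTgt (nextCorner β p)` turns by
`+π/2` at the middle point (counter-clockwise around the vertex). [cite: Smirnov2001, §2] -/
theorem turning_nextCorner_of_not_mem {δ : ℝ} (hδ : δ ≠ 0) {p : Site 2 × Fin 4} (h : cTgt p ∉ β) :
    turning (medialPoint δ (cSrc p)) (medialPoint δ (cTgt p)) (medialPoint δ (cTgt (nextCorner β p))) =
      Real.pi / 2 := by
  rw [turning, nextCorner_of_not_mem h, medialPoint_cTgt, medialPoint_cTgt, medialPoint_cSrc]
  simp only
  rw [I_pow_fin_succ]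
  have hδ' : (δ : ℂ) ≠ 0 := Complex.ofReal_ne_zero.2 hδ
  have key : (meshPoint δ p.1 + ↑δ * (I ^ (p.2 : ℕ) * I * I) / 2 - (meshPoint δ p.1 + ↑δ * (I ^ (p.2 : ℕ) * I) / 2)) /
      (meshPoint δ p.1 + ↑δ * (I ^ (p.2 : ℕ) * I) / 2 - (meshPoint δ p.1 + ↑δ * I ^ (p.2 : ℕ) / 2)) = I := by
    have h1 : meshPoint δ p.1 + ↑δ * (I ^ (p.2 : ℕ) * I * I) / 2 - (meshPoint δ p.1 + ↑δ * (I ^ (p.2 : ℕ) * I) / 2)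
        = I * (↑δ * I ^ (p.2 : ℕ) * (I - 1) / 2) := by ring
    have h2 : meshPoint δ p.1 + ↑δ * (I ^ (p.2 : ℕ) * I) / 2 - (meshPoint δ p.1 + ↑δ * I ^ (p.2 : ℕ) / 2)
        = ↑δ * I ^ (p.2 : ℕ) * (I - 1) / 2 := by ring
    rw [h1, h2, mul_div_assoc, div_self (by simp [hδ', I_sub_one_ne_zero]), mul_one]
  rw [key, Complex.arg_I]

/-- **Following an open edge is a right turn.** If the target edge of `p` is open, the polyline
through the midpoints of `cSrc p`, `cTgt p`, `cTgt (nextCorner β p)` turns by `-π/2` at the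
middle point (clockwise inside the face). [cite: Smirnov2001, §2] -/
theorem turning_nextCorner_of_mem {δ : ℝ} (hδ : δ ≠ 0) {p : Site 2 × Fin 4} (h : cTgt p ∈ β) :
    turning (medialPoint δ (cSrc p)) (medialPoint δ (cTgt p)) (medialPoint δ (cTgt (nextCorner β p))) =
      -(Real.pi / 2) := by
  rw [turning, nextCorner_of_mem h, medialPoint_cTgt, medialPoint_cTgt, medialPoint_cSrc]
  simp only
  rw [meshPoint_add', meshPoint, meshPoint, toComplex_cornerUnit_succ, I_pow_fin_add_three_mul_I]
  have hδ' : (δ : ℂ) ≠ 0 := Complex.ofReal_ne_zero.2 hδ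
  have key : (↑δ * Site.toComplex p.1 + ↑δ * (I ^ (p.2 : ℕ) * I) + ↑δ * I ^ (p.2 : ℕ) / 2 -
        (↑δ * Site.toComplex p.1 + ↑δ * (I ^ (p.2 : ℕ) * I) / 2)) /
      (↑δ * Site.toComplex p.1 + ↑δ * (I ^ (p.2 : ℕ) * I) / 2 - (↑δ * Site.toComplex p.1 + ↑δ * I ^ (p.2 : ℕ) / 2))
      = -I := by
    have h1 : ↑δ * Site.toComplex p.1 + ↑δ * (I ^ (p.2 : ℕ) * I) + ↑δ * I ^ (p.2 : ℕ) / 2 -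
        (↑δ * Site.toComplex p.1 + ↑δ * (I ^ (p.2 : ℕ) * I) / 2) = (I + 1) * (↑δ * I ^ (p.2 : ℕ) / 2) := by ring
    have h2 : ↑δ * Site.toComplex p.1 + ↑δ * (I ^ (p.2 : ℕ) * I) / 2 - (↑δ * Site.toComplex p.1 + ↑δ * I ^ (p.2 : ℕ) / 2)
        = (I - 1) * (↑δ * I ^ (p.2 : ℕ) / 2) := by ring
    rw [h1, h2, mul_div_mul_right _ _ (by simp [hδ'])]
    rw [div_eq_iff I_sub_one_ne_zero]
    ring_nf
    rw [I_sq]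
    ring
  rw [key, Complex.arg_neg_I]


/-- The turning angle of the exploration at the end of the corner `p`: `-π/2` (right) if it
follows the open target edge, `+π/2` (left) if it crosses the closed one. [cite: Smirnov2001, §2] -/
def turnOf (β : Percolation.BondConfig (Site 2)) (p : Site 2 × Fin 4) : ℝ :=
  by classical exact if cTgt p ∈ β then -(Real.pi / 2) else Real.pi / 2

/-- **Every step of the exploration turns by `turnOf`.** [cite: Smirnov2001, §2] -/
theorem turning_nextCorner {δ : ℝ} (hδ : δ ≠ 0) (p : Site 2 × Fin 4) :
    turning (medialPoint δ (cSrc p)) (medialPoint δ (cTgt p)) (medialPoint δ (cTgt (nextCorner β p))) =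
      turnOf β p := by
  classical
  unfold turnOf
  split_ifs with h
  · exact turning_nextCorner_of_mem hδ h
  · exact turning_nextCorner_of_not_mem hδ h

/-- The orbit starts at its start corner (general configuration). [cite: Smirnov2001, §2] -/
theorem cornerOrbit_zero' (c : Site 2 × Fin 4) : cornerOrbit β c 0 = c := rfl

/-- Shifting the orbit: the orbit from `c` after one step is the orbit from `nextCorner β c`.
[cite: Smirnov2001, §2] -/
theorem cornerOrbit_succ_eq (c : Site 2 × Fin 4) (i : ℕ) :
    cornerOrbit β c (i + 1) = cornerOrbit β (nextCorner β c) i := by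
  induction i with
  | zero => rfl
  | succ i ih =>
    change nextCorner β (cornerOrbit β c (i + 1)) = nextCorner β (cornerOrbit β (nextCorner β c) i)
    rw [ih]

/-- The polyline points of the first `n + 1` orbit corners from `c`: the midpoints of their source
edges. [cite: Smirnov2001, §2] -/
def orbitPts (δ : ℝ) (β : Percolation.BondConfig (Site 2)) (c : Site 2 × Fin 4) (n : ℕ) : List ℂ :=
  (List.range (n + 1)).map fun i => medialPoint δ (cSrc (cornerOrbit β c i))

/-- Peeling the first point off the orbit polyline. [cite: Smirnov2001, §2] -/
theorem orbitPts_succ (δ : ℝ) (c : Site 2 × Fin 4) (n : ℕ) :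
    orbitPts δ β c (n + 1) = medialPoint δ (cSrc c) :: orbitPts δ β (nextCorner β c) n := by
  rw [orbitPts, List.range_succ_eq_map, List.map_cons, List.map_map, orbitPts]
  congr 1
  refine List.map_congr_left fun i _ => ?_
  simp [cornerOrbit_succ_eq]

/-- **The winding of the exploration polyline is the sum of its turns**: the polyline through
the source midpoints of the orbit corners `c = c₀, c₁, …, c_n` has winding
`∑_{i < n - 1} turnOf β cᵢ` (it turns at the interior points `c₁, …, c_{n-1}`, the turn at
`cᵢ₊₁`'s source being the turn at the end of `cᵢ`). [cite: Smirnov2001, §2] -/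
theorem winding_orbitPts {δ : ℝ} (hδ : δ ≠ 0) (c : Site 2 × Fin 4) (n : ℕ) :
    winding (orbitPts δ β c n) = ∑ i ∈ Finset.range (n - 1), turnOf β (cornerOrbit β c i) := by
  induction n generalizing c with
  | zero => simp [orbitPts]
  | succ n ih =>
    rcases n with _ | n
    · simp [orbitPts, List.range_succ]
    · rw [orbitPts_succ, orbitPts_succ, show n + 1 + 1 - 1 = n + 1 from rfl, Finset.sum_range_succ']
      rcases n with _ | n
      · simp only [orbitPts, zero_add, List.range_one, List.map_cons, List.map_nil, winding_cons_cons_cons,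
          winding_pair, add_zero, Finset.range_zero, Finset.sum_empty, zero_add]
        rw [cSrc_nextCorner, cornerOrbit_zero', cSrc_nextCorner]
        exact turning_nextCorner hδ c
      · have h3 := orbitPts_succ δ (β := β) (nextCorner β (nextCorner β c)) n
        rw [h3, winding_cons_cons_cons, ← h3, ← orbitPts_succ, ih, cSrc_nextCorner, cSrc_nextCorner,
          turning_nextCorner hδ c, show n + 1 + 1 - 1 = n + 1 from rfl, add_comm]
        congr 1
        refine Finset.sum_congr rfl fun i _ => ?_
        rw [cornerOrbit_succ_eq]


/-- The polyline of the cut orbit `explorationList β c₀ N` (the exploration path of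
`MedialInterfaceProofs`) is `orbitPts`. [cite: Smirnov2001, §2] -/
theorem map_medialPoint_explorationList (δ : ℝ) (c₀ : Site 2 × Fin 4) (N : ℕ) :
    (explorationList β c₀ N).map (medialPoint δ) = orbitPts δ β c₀ N := by
  simp [explorationList, orbitPts, List.map_map, Function.comp_def]

/-- Prefixes of the orbit polyline are orbit polylines. [cite: Smirnov2001, §2] -/
theorem take_orbitPts (δ : ℝ) (c : Site 2 × Fin 4) {k n : ℕ} (hk : k ≤ n) :
    (orbitPts δ β c n).take (k + 1) = orbitPts δ β c k := by
  rw [orbitPts, orbitPts, ← List.map_take, List.take_range, Nat.min_eq_left (by omega)]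

/-- **The winding of the exploration path up to its `k`-th vertex**, for `k < N`: the average of
the windings on arrival (`∑_{i<k-1}` turns) and on departure (`∑_{i<k}` turns), as `windingAt`
prescribes. [cite: Smirnov2010, §2.2] -/
theorem windingAt_explorationList {δ : ℝ} (hδ : δ ≠ 0) (c₀ : Site 2 × Fin 4) {k N : ℕ} (hk : k < N) :
    windingAt (explorationList β c₀ N) δ k =
      ((∑ i ∈ Finset.range (k - 1), turnOf β (cornerOrbit β c₀ i)) +
        ∑ i ∈ Finset.range k, turnOf β (cornerOrbit β c₀ i)) / 2 := by
  rw [windingAt, map_medialPoint_explorationList, take_orbitPts δ c₀ hk.le,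
    take_orbitPts δ c₀ (Nat.succ_le_of_lt hk), winding_orbitPts hδ, winding_orbitPts hδ]
  rfl

/-- The winding at the last vertex of the exploration path (its `N`-th, the edge `e_b`): the total
winding `∑_{i<N-1}` of the polyline (arrival only; `windingAt`'s junk-free last value).
[cite: Smirnov2010, §2.2] -/
theorem windingAt_explorationList_last {δ : ℝ} (hδ : δ ≠ 0) (c₀ : Site 2 × Fin 4) (N : ℕ) :
    windingAt (explorationList β c₀ N) δ N = ∑ i ∈ Finset.range (N - 1), turnOf β (cornerOrbit β c₀ i) := by
  rw [windingAt, map_medialPoint_explorationList, take_orbitPts δ c₀ le_rfl,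
    List.take_of_length_le (by simp [orbitPts]), winding_orbitPts hδ]
  ring

/-- The sign of the turn at the end of the corner `p`: `-1` (right) across an open target edge,
`+1` (left) across a closed one; `turnOf = (π/2) · turnSign`. [cite: Smirnov2001, §2] -/
def turnSign (β : Percolation.BondConfig (Site 2)) (p : Site 2 × Fin 4) : ℤ :=
  by classical exact if cTgt p ∈ β then -1 else 1

/-- `turnOf = (π / 2) · turnSign`. [cite: Smirnov2001, §2] -/
theorem turnOf_eq (p : Site 2 × Fin 4) : turnOf β p = Real.pi / 2 * turnSign β p := by
  classical
  unfold turnOf turnSign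
  split_ifs <;> push_cast <;> ring

/-- Sums of turns are `π / 2` times sums of turn signs. [cite: Smirnov2001, §2] -/
theorem sum_turnOf_eq (c : Site 2 × Fin 4) (n : ℕ) :
    ∑ i ∈ Finset.range n, turnOf β (cornerOrbit β c i) =
      Real.pi / 2 * ∑ i ∈ Finset.range n, (turnSign β (cornerOrbit β c i) : ℝ) := by
  rw [Finset.mul_sum]
  exact Finset.sum_congr rfl fun i _ => turnOf_eq _

end Literature.Probability.LatticeModels
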